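import Summits.HodgeConjecture.HodgeConjecture.Theorems.Ring2AbelianAllAndreStandardANumerical
import Summits.HodgeConjecture.HodgeConjecture.Theorems.Ring2AbelianAllAndreLiebermanDischargedRows
import Summits.HodgeConjecture.HodgeConjecture.Theorems.Ring2AbelianAllAndreFibreClassKernelOfDeligne
import Summits.HodgeConjecture.HodgeConjecture.Theorems.Ring2AbelianAllAndreFibreClassKernelHolds
import Summits.HodgeConjecture.HodgeConjecture.Theorems.Ring2AbelianAllAndreNumericalLift
import Summits.HodgeConjecture.HodgeConjecture.Theorems.Ring2AbelianAllAndreHomNumUnconditional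
import Literature.AlgebraicGeometry.HodgeTheory.InvariantClassesFromTotalSpaceHolds
import HarnessLib

/-!
# Ring 2 · sub-cell AbelianAll (ALL ABELIAN VARIETIES), André axis, part XXX-a — "HOM ≡ NUM" ON THE INVARIANT
# ALGEBRAIC CLASSES OF A FIBRE, UNCONDITIONALLY; hence the lift (L)_t(p) IS the invariant part of the numerical
# hypothesis (Num_t)(p,q) — no Hodge-conjecture input on the fibre

HONEST FRAMING (page 1, verbatim): **research route, not a corollary; conditional on HC_CM plus one named
minimal statement.** Cell line: research route conditional on HC_CM; not a corollary; Q11.4-sentence-2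
already refuted in dim ≥ 3. Nothing in this file proves a case of the Hodge conjecture for an abelian variety;
`HC_CM` (`Theses.RankFourFaces.CMAbelianHodge`) does not occur in this file; item `Theses.RankFourFaces.CMToAbelian`
(stmt-HodgeConjecture-16267) OPEN and not closed here. Seat `pub-hodge-ring2-ab-andre-2`, gen 22; brief (ii) "record each
version; prove the implications between them" and (iii) "identify precisely why Lieberman's `B(A)` does not suffice …
smallest open instance stated as a find-the-cycle problem".

## The point

For a compact pencil `f : 𝒳 ⟶ S` of abelian `d`-folds, a point `t` (`j_t : X_t ↪ 𝒳`) and `p + q = d`, write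
`I_k = Im (j_t^* : Hᵏ(𝒳) → Hᵏ(X_t))` (the invariant classes) and `N^p_inv = N^p(X_t) ∩ I_{2p}` (the INVARIANT ALGEBRAIC
classes of the fibre). Lieberman's theorem (in the tree: `nondegenerate_fiberOver`) says the cup pairing
`N^p(X_t) × N^q(X_t) → H^{2d}` is non-degenerate; this does NOT pass to the subspaces `N^p_inv × N^q_inv` for free (a subspace of
a non-degenerate pairing may be degenerate — e.g. the isotropic divisor class `[E × pt]` on `E × E'`). §2 proves that it does:

**THEOREM (§2, unconditional).** `N^p_inv × N^q_inv → H^{2d}(X_t(ℂ); ℂ)` is non-degenerate on both sides.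

PROOF. Let `K` be a global class whose restriction `κ = j_t^*K` is the rational Kähler class of a Kähler–rational datum `D` of
`X_t` (part XII-a `exists_globalKaehlerClass`). The subspaces `N^•_inv` are stable under the LEFSCHETZ DECOMPOSITION of `κ`:
the Lefschetz terms `L^{s'} ξ_P x` of `x ∈ N^p_inv` are ALGEBRAIC (Kleiman's argument under `A(X_t, κ)`, which holds on the
abelian fibre by Lieberman — tree theorems `standardConjectureA_fiberOver`, `lefschetzPowTo_primitivePart_mem_algebraicClasses_…`)
and INVARIANT (Deligne: the primitive components of the restriction of a global class are restrictions of global classes —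
the tree's DISCHARGED fact `deligne1968_invariantClass_fromTotalSpace_holds` through part XII-a
`exists_primitivePart_map_fiberι_eq`). Hence the polarisation form `Q_D(conj ξ, ·) = τ(z ∪ ·)` has `z ∈ N^q_inv` (part XVIII-b's
cup-product bridge), so `ξ ⊥ N^q_inv` gives `Q_D(x, conj x) = 0` for `x = conj ξ`, a class of pure type `(p,p)`, whence
`x = 0` by the second Hodge–Riemann relation (`KaehlerRationalDatum.cform_conj_pos`). This is exactly part XVIII-b's
"`HC ⟹ D`" with the Hodge span replaced by `N^•_inv` — the one new input being the invariance of the Lefschetz terms.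

**CONSEQUENCE (§3).** The lift (L)_t(p) `(j_t^*)⁻¹ N^p(X_t) ≤ N^p(𝒳) + ker j_t^*` is EQUIVALENT to the INVARIANT PART
(Num_t)^{inv}(p,q) of part XVIII's numerical hypothesis: "for `b ∈ N^q_inv` with `a ∪ j_{t*} b = 0` for all `a ∈ N^p(𝒳)`,
`j_{t*} b = 0`". (`⟸` is part XVIII-a's bi-orthogonality argument run inside `N^p_inv × N^q_inv`; `⟹` is new and needs
NO Hodge hypothesis on the fibre — parts XVIII-c/XXIX-e had `(L) ⟹ (Num)` only at fibres satisfying `HC`.) In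
find-the-cycle form: **(L)_t(p) holds iff every non-zero invariant algebraic class `b` of degree `2q` on the fibre is
numerically detected by a global algebraic class: `∃ a ∈ N^p(𝒳)`, `j_t^* a ∪ b ≠ 0`.** Smallest open instance
`(d, p, q) = (4, 2, 2)`: a compact pencil of abelian fourfolds, `b` an invariant algebraic surface class on `X_t`,
`a` an algebraic threefold class on the fivefold `𝒳`.

## What is proved (theorems only; no definition, no named fact, no sorry)

§1 `conjClass_mem_algebraicClasses_inf_range`, **`lefschetzPowTo_primitivePart_mem_algebraicClasses_inf_range`**,
`map_fiberι_mem_range_zero`. §2 **`eq_zero_of_forall_cupProduct_eq_zero_of_invariant`** (left), **`…'`** (right),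
**`nondegenerate_invariant_fiberOver`**. §3 **`numericalInv_of_comap_le_sup`** ((L)_t(p) ⟹ (Num_t)^{inv}(p,q)),
**`comap_le_sup_of_numericalInv`** (⟸), **`comap_le_sup_iff_numericalInv`**, **`comap_le_sup_iff_detect`** (find-the-cycle
form), `numerical₁_of_comap_le_sup` (part XXIX-a's (Num₁)(p,q) ⟸ (L)_t(p)), `comap_le_sup_iff_detect_relDim_four` (`d = 4`).

References: Lieberman1968 (Thm. 1, main theorem); Kleiman1968AlgebraicCycles (§3 Prop. 3.8, Cor. 3.9); Grothendieck1968 (§3);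
VoisinHodgeI2002 (§6.2.3 Cor. 6.26, Lemma 6.29, §6.3.2 Thm. 6.32, §7.1.2); VoisinHodgeII2003 (§4.2.3 Thm. 4.15, §4.3.1
Thm. 4.18); Deligne1968 (Prop. 2.1, (2.6.3)); DeligneHodgeII1971 (Thm. 4.1.1); Milne2020HodgeClassesAV (Prop. 1 p. 7);
Andre1996Motifs (§5.1, §6.3); FultonYoungTableaux1997 (App. B §B.1 (6)); HatcherAT2002 (§3.3 Prop. 3.38).
-/

noncomputable section

set_option linter.dupNamespace false

namespace Summit.HodgeConjecture.HodgeConjecture.Ring2.AbelianAll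

open CategoryTheory AlgebraicGeometry
open Literature.AlgebraicGeometry Literature.AlgebraicGeometry.Motives
open Literature.AlgebraicGeometry.HodgeTheory
open Literature.AlgebraicTopology.SingularHomology (singularCohomology cupProduct cupProduct_gradedComm_holds)
open Literature.Geometry.Kaehler (lefschetzOperator HasHardLefschetzProperty)

variable {𝒳 S : SchemeOver ℂ} {d : ℕ} {f : 𝒳 ⟶ S}

/-! ## §1 The Lefschetz terms of an invariant algebraic class are invariant algebraic classes -/

/-- `N^p(X_t) ∩ Im j_t^*` is stable under complex conjugation: algebraic classes are spanned by rational (real) classes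
(`conjClass_mem_algebraicClasses`) and `j_t^*` is real (`conjClass_map`). [cite: VoisinHodgeI2002, Cor. 6.12] -/
theorem conjClass_mem_algebraicClasses_inf_range (hf : IsCompactAbelianPencil f d) (t : ComplexPoints S) (p : ℕ)
    {x : complexBetti (fiberOver f t) (2 * p)}
    (hx : x ∈ algebraicClasses (fiberOver f t) p ⊓ LinearMap.range (complexBetti.map (fiberι f t) (2 * p)).hom) :
    conjClass (ComplexPoints (fiberOver f t)) (2 * p) x ∈
      algebraicClasses (fiberOver f t) p ⊓ LinearMap.range (complexBetti.map (fiberι f t) (2 * p)).hom := by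
  obtain ⟨hxN, ⟨W, hW⟩⟩ := hx
  refine ⟨conjClass_mem_algebraicClasses (hf.isSmoothProjective_fiberOver t) p hxN,
    ⟨conjClass (ComplexPoints 𝒳) (2 * p) W, ?_⟩⟩
  rw [← hW]
  change singularCohomology.map ℂ ℂ _ (2 * p) (conjClass _ (2 * p) W) =
    conjClass _ (2 * p) (singularCohomology.map ℂ ℂ _ (2 * p) W)
  rw [conjClass_map]

/-- **The Lefschetz terms `L_κ^{s'} ξ_P x` (`P = (a, t)`, `a + t + s' = d`) of an invariant algebraic class `x ∈ N^p(X_t) ∩ Im j_t^*`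
are invariant algebraic classes of codimension `q = d - p`**, for `κ = j_t^* K = D.Hη` the restriction of a global class `K`
(hard Lefschetz on every fibre) which is the rational Kähler class of a Kähler–rational datum `D` of the fibre. ALGEBRAIC:
Kleiman's argument under `A(X_t, κ)` (Lieberman, the tree's `standardConjectureA_fiberOver`); INVARIANT: the primitive
components of `j_t^* A` are restrictions of global classes (Deligne, the tree's discharged `deligne1968_invariantClass_fromTotalSpace_holds`
through part XII-a), and `j_t^*` intertwines `L_K` and `L_κ`. [cite: Kleiman1968AlgebraicCycles, §3 (proof of Prop. 3.8)]
[cite: Lieberman1968, main theorem] [cite: Deligne1968, Prop. 2.1 and (2.6.3)] [cite: VoisinHodgeII2003, §4.3.1 Thm. 4.18] -/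
theorem lefschetzPowTo_primitivePart_mem_algebraicClasses_inf_range (hf : IsCompactAbelianPencil f d)
    (t : ComplexPoints S) {K : complexBetti 𝒳 2}
    (hK : ∀ s : ComplexPoints S, HasHardLefschetzProperty (complexBetti.map (fiberι f s) 2 K) d)
    (D : KaehlerRationalDatum d (fiberOver f t)) (hKD : complexBetti.map (fiberι f t) 2 K = D.Hη)
    {p q : ℕ} (hpq : p + q = d) {x : complexBetti (fiberOver f t) (2 * p)}
    (hx : x ∈ algebraicClasses (fiberOver f t) p ⊓ LinearMap.range (complexBetti.map (fiberι f t) (2 * p)).hom)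
    (P : {P : ℕ × ℕ // P.1 + 2 * P.2 = 2 * p}) (s' : ℕ) (hs' : P.1.1 + P.1.2 + s' = d) (hq : P.1.1 + 2 * s' = 2 * q) :
    lefschetzPowTo D.Hη s' P.1.1 (2 * q) hq
        (primitivePart D.Hη d (D.hLℂ (hf.isSmoothProjective_fiberOver t))
          (subsingleton_of_lt (hf.isSmoothProjective_fiberOver t) ℂ) P x) ∈
      algebraicClasses (fiberOver f t) q ⊓ LinearMap.range (complexBetti.map (fiberι f t) (2 * q)).hom := by
  have hXt := hf.isSmoothProjective_fiberOver t
  obtain ⟨hxN, ⟨A, hA⟩⟩ := hx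
  refine ⟨?_, ?_⟩
  · -- algebraic: Kleiman under `A(X_t, κ)` (Lieberman)
    have hAt := standardConjectureA_fiberOver hf t (isPolarizationClass_Hη hXt D)
    exact lefschetzPowTo_primitivePart_mem_algebraicClasses_of_surjOn_lt hXt D hpq
      (fun p' r' q' _ _ h3 h4 ↦ (hAt.2 p' r' q' h3 h4).surjOn) hxN P s' hs' hq
  · -- invariant: Deligne
    obtain ⟨B, hB⟩ := exists_primitivePart_map_fiberι_eq deligne1968_invariantClass_fromTotalSpace_holds hf K hK A P t
    have hA' : complexBetti.map (fiberι f t) (2 * p) A = x := hA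
    rw [hA', primitivePart_congr hKD (hK t) (D.hLℂ hXt) (hvan_fiberOver hf t) P] at hB
    refine ⟨lefschetzPowTo K s' P.1.1 (2 * q) hq B, ?_⟩
    change complexBetti.map (fiberι f t) (2 * q) (lefschetzPowTo K s' P.1.1 (2 * q) hq B) = _
    rw [map_fiberι_lefschetzPowTo t K s' P.1.1 (2 * q) hq B, hKD, ← hB]

/-- In degree `0` every class of the fibre is invariant: `H⁰(X_t(ℂ); ℂ) = ℂ · 1 = ℂ · j_t^* 1`. [cite: HatcherAT2002, §3.2 Prop. 3.10] -/
theorem map_fiberι_mem_range_zero (hf : IsCompactAbelianPencil f d) (t : ComplexPoints S)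
    (b : complexBetti (fiberOver f t) (2 * 0)) :
    b ∈ LinearMap.range (complexBetti.map (fiberι f t) (2 * 0)).hom := by
  obtain ⟨c, hc⟩ := exists_eq_smul_one complexOrientationFamily (hf.isSmoothProjective_fiberOver t) b
  refine ⟨c • singularCohomology.one ℂ (ComplexPoints 𝒳), ?_⟩
  change complexBetti.map (fiberι f t) (2 * 0) (c • singularCohomology.one ℂ (ComplexPoints 𝒳)) = b
  rw [map_smul, hc]
  exact congrArg (c • ·) (singularCohomology.map_one (R := ℂ) (Motives.AlgPoints.mapContinuous (L := ℂ) (fiberι f t)))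

/-! ## §2 Hom ≡ num on the invariant algebraic classes of the fibre, unconditionally -/

/-- **LEFT NON-DEGENERACY OF THE CUP PAIRING ON INVARIANT ALGEBRAIC CLASSES.** For a compact pencil of abelian `d`-folds,
a point `t`, `p + q = d`, and `ξ ∈ N^p(X_t) ∩ Im j_t^*`: if `ξ ∪ b = 0` for every `b ∈ N^q(X_t) ∩ Im j_t^*`, then `ξ = 0`.
PROOF: part XVIII-b's argument with the Hodge spans replaced by `N^•(X_t) ∩ Im j_t^*` — for `x = conj ξ` (again invariant
algebraic, §1) the polarisation form of the fibre datum `D` with `D.Hη = j_t^*K` satisfies `Q_D(x, ·) = τ(z ∪ ·)` with `z`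
in the span of the Lefschetz terms of `x`, all in `N^q(X_t) ∩ Im j_t^*` (§1), so `Q_D(x, conj x) = ± τ(ξ ∪ z) = 0`; and
`Q_D(x, conj x) ≠ 0` for `0 ≠ x` of pure type `(p,p)` (second Hodge–Riemann relation, the tree's `cform_conj_pos`). For
`d = 0` every class is invariant and this is Lieberman's theorem itself. No Hodge-conjecture hypothesis on the fibre.
[cite: Lieberman1968, main theorem] [cite: Kleiman1968AlgebraicCycles, §3 Prop. 3.8] [cite: VoisinHodgeI2002, §6.3.2 Thm. 6.32 and §7.1.2]
[cite: Deligne1968, (2.6.3)] -/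
theorem eq_zero_of_forall_cupProduct_eq_zero_of_invariant (hf : IsCompactAbelianPencil f d) (t : ComplexPoints S)
    {p q : ℕ} (hpq : p + q = d) {ξ : complexBetti (fiberOver f t) (2 * p)}
    (hξ : ξ ∈ algebraicClasses (fiberOver f t) p ⊓ LinearMap.range (complexBetti.map (fiberι f t) (2 * p)).hom)
    (h : ∀ b ∈ algebraicClasses (fiberOver f t) q ⊓ LinearMap.range (complexBetti.map (fiberι f t) (2 * q)).hom,
      cupProduct (show 2 * p + 2 * q = 2 * d by omega) ξ b = 0) :
    ξ = 0 := by
  have hXt := hf.isSmoothProjective_fiberOver t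
  rcases Nat.eq_zero_or_pos d with hd | hd
  · -- `d = 0`: `p = q = 0`, every class of degree `0` is invariant; Lieberman on the fibre
    subst hd
    obtain rfl : p = 0 := by omega
    obtain rfl : q = 0 := by omega
    exact (nondegenerate_fiberOver hf t (show 0 + 0 = 0 by rfl)).1 ξ hξ.1
      fun b hb ↦ h b ⟨hb, map_fiberι_mem_range_zero hf t b⟩
  -- `d ≥ 1`: Hodge–Riemann for the restricted global Kähler class
  obtain ⟨K, D, hKD, hK⟩ := exists_globalKaehlerClass hf hd t
  obtain ⟨A⟩ := nonempty_hodgeModel_holds hXt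
  have hI := hodgePQ_independent_of_hodgeModel_holds
  set x := conjClass (ComplexPoints (fiberOver f t)) (2 * p) ξ with hxdef
  have hx : x ∈ algebraicClasses (fiberOver f t) p ⊓ LinearMap.range (complexBetti.map (fiberι f t) (2 * p)).hom :=
    conjClass_mem_algebraicClasses_inf_range hf t p hξ
  -- `Q_D(x, ·) = τ(z ∪ ·)` with `z ∈ N^q ∩ Im j_t^*`
  obtain ⟨z, hz, hQ⟩ := exists_polarizationForm_eq_trace_cupProduct (D.hLℂ hXt) (subsingleton_of_lt hXt ℂ)
    (D.cTrace hXt) (show 2 * q + 2 * p = 2 * d by omega) x _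
    (fun P s' hs' hq ↦ lefschetzPowTo_primitivePart_mem_algebraicClasses_inf_range hf t hK D hKD hpq hx P s' hs' hq)
  -- `Q_D(x, conj x) = τ(z ∪ ξ) = τ(ξ ∪ z) = 0`
  have h0 : D.cform hXt (2 * p) x (conjClass (ComplexPoints (fiberOver f t)) (2 * p) x) = 0 := by
    rw [hxdef, conjClass_conjClass ξ, ← hxdef, KaehlerRationalDatum.cform, hQ,
      cupProduct_gradedComm_holds ℂ (ComplexPoints (fiberOver f t)) (show 2 * q + 2 * p = 2 * d by omega)
        (show 2 * p + 2 * q = 2 * d by omega) z ξ, h z hz, smul_zero, map_zero]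
  -- Hodge–Riemann: `x = 0`
  by_contra hξ0
  have hx0 : x ≠ 0 := by
    intro hx0
    apply hξ0
    rw [← conjClass_conjClass ξ, ← hxdef, hx0, conjClass_zero]
  have hpp : (p, p) ∈ Finset.HasAntidiagonal.antidiagonal (2 * p) := Finset.HasAntidiagonal.mem_antidiagonal.2 (by omega)
  have hxA : x ∈ A.typePiece (2 * p) ⟨(p, p), hpp⟩ :=
    A.mem_typePiece_of_isOfHodgeType hI hXt hpp (isOfHodgeType_of_mem_algebraicClasses_of_isSmoothProjective hXt p hx.1)
  obtain ⟨r, hr, hQr⟩ := D.cform_conj_pos hXt A hpp hxA hx0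
  rw [h0, mul_zero] at hQr
  exact hr.ne' (by exact_mod_cast hQr.symm)

/-- **RIGHT NON-DEGENERACY** (exchange `p`, `q`; graded commutativity in even degrees). [cite: Lieberman1968, main theorem]
[cite: Kleiman1968AlgebraicCycles, §3 Prop. 3.8] [cite: VoisinHodgeI2002, §6.3.2 Thm. 6.32] -/
theorem eq_zero_of_forall_cupProduct_eq_zero_of_invariant' (hf : IsCompactAbelianPencil f d) (t : ComplexPoints S)
    {p q : ℕ} (hpq : p + q = d) {b : complexBetti (fiberOver f t) (2 * q)}
    (hb : b ∈ algebraicClasses (fiberOver f t) q ⊓ LinearMap.range (complexBetti.map (fiberι f t) (2 * q)).hom)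
    (h : ∀ ξ ∈ algebraicClasses (fiberOver f t) p ⊓ LinearMap.range (complexBetti.map (fiberι f t) (2 * p)).hom,
      cupProduct (show 2 * p + 2 * q = 2 * d by omega) ξ b = 0) :
    b = 0 := by
  refine eq_zero_of_forall_cupProduct_eq_zero_of_invariant hf t (show q + p = d by omega) hb fun ξ hξ ↦ ?_
  rw [cupProduct_gradedComm_holds ℂ (ComplexPoints (fiberOver f t)) (show 2 * q + 2 * p = 2 * d by omega)
    (show 2 * p + 2 * q = 2 * d by omega) b ξ, h ξ hξ, smul_zero]

/-- **HOM ≡ NUM ON THE INVARIANT ALGEBRAIC CLASSES OF A FIBRE, BOTH SIDES, UNCONDITIONALLY**: on a compact pencil of abelian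
`d`-folds, at every point `t` and for `p + q = d`, the cup pairing `(N^p(X_t) ∩ Im j_t^*) × (N^q(X_t) ∩ Im j_t^*) → H^{2d}(X_t(ℂ); ℂ)`
is non-degenerate on both sides. (Lieberman's theorem is the same for `N^p(X_t) × N^q(X_t)`; the passage to invariants is the
invariance of the Lefschetz components, Deligne.) [cite: Lieberman1968, main theorem] [cite: Deligne1968, (2.6.3)]
[cite: Kleiman1968AlgebraicCycles, §3] -/
theorem nondegenerate_invariant_fiberOver (hf : IsCompactAbelianPencil f d) (t : ComplexPoints S) {p q : ℕ}
    (hpq : p + q = d) :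
    (∀ ξ ∈ algebraicClasses (fiberOver f t) p ⊓ LinearMap.range (complexBetti.map (fiberι f t) (2 * p)).hom,
        (∀ b ∈ algebraicClasses (fiberOver f t) q ⊓ LinearMap.range (complexBetti.map (fiberι f t) (2 * q)).hom,
          cupProduct (show 2 * p + 2 * q = 2 * d by omega) ξ b = 0) → ξ = 0) ∧
      (∀ b ∈ algebraicClasses (fiberOver f t) q ⊓ LinearMap.range (complexBetti.map (fiberι f t) (2 * q)).hom,
        (∀ ξ ∈ algebraicClasses (fiberOver f t) p ⊓ LinearMap.range (complexBetti.map (fiberι f t) (2 * p)).hom,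
          cupProduct (show 2 * p + 2 * q = 2 * d by omega) ξ b = 0) → b = 0) :=
  ⟨fun _ hξ h ↦ eq_zero_of_forall_cupProduct_eq_zero_of_invariant hf t hpq hξ h,
    fun _ hb h ↦ eq_zero_of_forall_cupProduct_eq_zero_of_invariant' hf t hpq hb h⟩

/-! ## §3 The lift (L)_t(p) IS the invariant part of (Num_t)(p,q) -/

/-- The restriction of a global algebraic class is an invariant algebraic class: `j_t^* N^p(𝒳) ≤ N^p(X_t) ∩ Im j_t^*`
(Fulton pull-back, the tree's `algebraicClasses_sup_ker_le_comap`). [cite: Fulton1998, §19.1 and Prop. 19.1.2] -/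
theorem map_algebraicClasses_le_inf_range (hf : IsCompactAbelianPencil f d) (t : ComplexPoints S) (p : ℕ) :
    (algebraicClasses 𝒳 p).map (complexBetti.map (fiberι f t) (2 * p)).hom ≤
      algebraicClasses (fiberOver f t) p ⊓ LinearMap.range (complexBetti.map (fiberι f t) (2 * p)).hom := by
  rintro _ ⟨a, ha, rfl⟩
  exact ⟨algebraicClasses_sup_ker_le_comap hf p t (Submodule.mem_sup_left ha), ⟨a, rfl⟩⟩

/-- **Under (L)_t(p) the invariant algebraic classes ARE the restricted ones: `N^p(X_t) ∩ Im j_t^* = j_t^* N^p(𝒳)`.**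
[cite: Milne2020HodgeClassesAV, Prop. 1 (p. 7)] [cite: Andre1996Motifs, §5.1 (p. 25)] -/
theorem inf_range_eq_map_of_comap_le_sup (hf : IsCompactAbelianPencil f d) (t : ComplexPoints S) (p : ℕ)
    (hL : (algebraicClasses (fiberOver f t) p).comap (complexBetti.map (fiberι f t) (2 * p)).hom ≤
      algebraicClasses 𝒳 p ⊔ LinearMap.ker (complexBetti.map (fiberι f t) (2 * p)).hom) :
    algebraicClasses (fiberOver f t) p ⊓ LinearMap.range (complexBetti.map (fiberι f t) (2 * p)).hom =
      (algebraicClasses 𝒳 p).map (complexBetti.map (fiberι f t) (2 * p)).hom := by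
  refine le_antisymm ?_ (map_algebraicClasses_le_inf_range hf t p)
  rintro ξ ⟨hξN, ⟨W, hW⟩⟩
  have hWc : W ∈ (algebraicClasses (fiberOver f t) p).comap (complexBetti.map (fiberι f t) (2 * p)).hom := by
    rw [Submodule.mem_comap, hW]
    exact hξN
  obtain ⟨a, ha, k, hk, hak⟩ := Submodule.mem_sup.1 (hL hWc)
  refine ⟨a, ha, ?_⟩
  rw [LinearMap.mem_ker] at hk
  rw [← hW, ← hak, map_add, hk, add_zero]

/-- **(L)_t(p) ⟹ (Num_t)^{inv}(p,q)** (`p + q = d`), NO HODGE HYPOTHESIS ON THE FIBRE: if every global class algebraic on `X_t`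
is algebraic on `𝒳` up to `ker j_t^*`, then every INVARIANT algebraic `b ∈ N^q(X_t) ∩ Im j_t^*` with `a ∪ j_{t*} b = 0` for all
`a ∈ N^p(𝒳)` has `j_{t*} b = 0` (indeed `b = 0`): `b` is cup-orthogonal to `j_t^* N^p(𝒳) = N^p(X_t) ∩ Im j_t^*` (transpose), hence
zero by §2. Parts XVIII-c / XXIX-e proved `(L) ⟹ (Num)` only at fibres satisfying the Hodge conjecture.
[cite: Kleiman1968AlgebraicCycles, §3 (D(X))] [cite: Lieberman1968, main theorem] [cite: FultonYoungTableaux1997, Appendix B §B.1 (6)] -/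
theorem numericalInv_of_comap_le_sup (hf : IsCompactAbelianPencil f d) (t : ComplexPoints S) {p q : ℕ} (hpq : p + q = d)
    (hL : (algebraicClasses (fiberOver f t) p).comap (complexBetti.map (fiberι f t) (2 * p)).hom ≤
      algebraicClasses 𝒳 p ⊔ LinearMap.ker (complexBetti.map (fiberι f t) (2 * p)).hom) :
    ∀ b ∈ algebraicClasses (fiberOver f t) q ⊓ LinearMap.range (complexBetti.map (fiberι f t) (2 * q)).hom,
      (∀ a ∈ algebraicClasses 𝒳 p,
        cupProduct (show 2 * p + 2 * (q + 1) = 2 * (d + 1) by omega) a (fiberGysin hf t q b) = 0) →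
        fiberGysin hf t q b = 0 := by
  intro b hb hab
  have hb0 : b = 0 := by
    refine eq_zero_of_forall_cupProduct_eq_zero_of_invariant' hf t hpq hb fun ξ hξ ↦ ?_
    rw [inf_range_eq_map_of_comap_le_sup hf t p hL] at hξ
    obtain ⟨a, ha, rfl⟩ := hξ
    exact (cupProduct_map_fiberι_eq_zero_iff hf t hpq a b).2 (hab a ha)
  rw [hb0, map_zero]

/-- **(Num_t)^{inv}(p,q) ⟹ (L)_t(p)** (`p + q = d`): part XVIII-a's bi-orthogonality argument run INSIDE the non-degenerate pairing
`(N^p ∩ Im j_t^*) × (N^q ∩ Im j_t^*)` of §2 — `V = j_t^* N^p(𝒳)` is cut out inside `N^p ∩ Im j_t^*` by its orthogonal in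
`N^q ∩ Im j_t^*`, and an invariant algebraic `b ⊥ V` has `j_{t*} b ⊥ N^p(𝒳)`, so `j_{t*} b = 0` by the hypothesis, so `b ⊥ Im j_t^*`.
Only INVARIANT test classes `b` are used (part XVIII-a / `comap_le_sup_of_numerical` quantified over all of `N^q(X_t)`).
[cite: Milne2020HodgeClassesAV, Prop. 1 (p. 7)] [cite: Kleiman1968AlgebraicCycles, §3 (D(X))] [cite: Lieberman1968, main theorem] -/
theorem comap_le_sup_of_numericalInv (hf : IsCompactAbelianPencil f d) (t : ComplexPoints S) {p q : ℕ} (hpq : p + q = d)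
    (hNum : ∀ b ∈ algebraicClasses (fiberOver f t) q ⊓ LinearMap.range (complexBetti.map (fiberι f t) (2 * q)).hom,
      (∀ a ∈ algebraicClasses 𝒳 p,
        cupProduct (show 2 * p + 2 * (q + 1) = 2 * (d + 1) by omega) a (fiberGysin hf t q b) = 0) →
        fiberGysin hf t q b = 0) :
    (algebraicClasses (fiberOver f t) p).comap (complexBetti.map (fiberι f t) (2 * p)).hom ≤
      algebraicClasses 𝒳 p ⊔ LinearMap.ker (complexBetti.map (fiberι f t) (2 * p)).hom := by
  have hXt := hf.isSmoothProjective_fiberOver t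
  haveI := finite_complexBetti hXt (2 * p)
  haveI := finite_complexBetti hXt (2 * q)
  intro W hW
  have hW' : complexBetti.map (fiberι f t) (2 * p) W ∈ algebraicClasses (fiberOver f t) p := hW
  set V : Submodule ℂ (complexBetti (fiberOver f t) (2 * p)) :=
    (algebraicClasses 𝒳 p).map (complexBetti.map (fiberι f t) (2 * p)).hom with hV
  have hξ : complexBetti.map (fiberι f t) (2 * p) W ∈
      algebraicClasses (fiberOver f t) p ⊓ LinearMap.range (complexBetti.map (fiberι f t) (2 * p)).hom := ⟨hW', ⟨W, rfl⟩⟩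
  obtain ⟨h₁, h₂⟩ := nondegenerate_invariant_fiberOver hf t hpq
  have hline : Module.finrank ℂ (complexBetti (fiberOver f t) (2 * d)) = 1 := finrank_complexBetti_two_mul_eq_one hXt
  have hmem : complexBetti.map (fiberι f t) (2 * p) W ∈ V := by
    refine mem_of_forall_orthogonal_of_nondegenerate' (cupProduct (show 2 * p + 2 * q = 2 * d by omega)) hline
      h₁ h₂ (map_algebraicClasses_le_inf_range hf t p) hξ fun b hb hbV ↦ ?_
    -- `b` kills `V = j^* N^p(𝒳)`, so `a ∪ j_* b = 0` for all algebraic `a`, so `j_* b = 0`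
    have hb0 : fiberGysin hf t q b = 0 := by
      refine hNum b hb fun a ha ↦ ?_
      rw [← cupProduct_map_fiberι_eq_zero_iff hf t hpq a b]
      exact hbV _ (Submodule.mem_map_of_mem ha)
    rw [cupProduct_map_fiberι_eq_zero_iff hf t hpq, hb0, map_zero]
  obtain ⟨η, hη, hηW⟩ := Submodule.mem_map.1 hmem
  rw [show W = η + (W - η) by abel]
  refine Submodule.add_mem_sup hη ?_
  rw [LinearMap.mem_ker, map_sub, sub_eq_zero]
  exact hηW.symm

/-- **(L)_t(p) ⟺ (Num_t)^{inv}(p,q)** (`p + q = d`) on EVERY compact pencil of abelian varieties, at EVERY point, with NO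
Hodge-conjecture hypothesis: the lift in degree `2p` IS "hom ≡ num, tested against `N^p(𝒳)`, for the fibre-supported classes
`j_{t*} b`, `b` invariant algebraic of degree `2q`". [cite: Kleiman1968AlgebraicCycles, §3 (D(X))] [cite: Milne2020HodgeClassesAV, Prop. 1 (p. 7)]
[cite: Lieberman1968, main theorem] -/
theorem comap_le_sup_iff_numericalInv (hf : IsCompactAbelianPencil f d) (t : ComplexPoints S) {p q : ℕ} (hpq : p + q = d) :
    (algebraicClasses (fiberOver f t) p).comap (complexBetti.map (fiberι f t) (2 * p)).hom ≤
        algebraicClasses 𝒳 p ⊔ LinearMap.ker (complexBetti.map (fiberι f t) (2 * p)).hom ↔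
      ∀ b ∈ algebraicClasses (fiberOver f t) q ⊓ LinearMap.range (complexBetti.map (fiberι f t) (2 * q)).hom,
        (∀ a ∈ algebraicClasses 𝒳 p,
          cupProduct (show 2 * p + 2 * (q + 1) = 2 * (d + 1) by omega) a (fiberGysin hf t q b) = 0) →
          fiberGysin hf t q b = 0 :=
  ⟨numericalInv_of_comap_le_sup hf t hpq, comap_le_sup_of_numericalInv hf t hpq⟩

/-- **THE LIFT AS A FIND-THE-CYCLE PROBLEM.** (L)_t(p) holds iff every NON-ZERO invariant algebraic class `b` of degree `2q`
on the fibre (`p + q = d`) is NUMERICALLY DETECTED by a global algebraic class: `∃ a ∈ N^p(𝒳)` with `j_t^* a ∪ b ≠ 0`.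
(`j_{t*} b ≠ 0 ⟺ b ≠ 0` for invariant `b`: Deligne's kernel identity κ_f, the tree's `fibreGysinKernelOn_holds`.)
[cite: Kleiman1968AlgebraicCycles, §3 (D(X))] [cite: DeligneHodgeII1971, Thm. 4.1.1] [cite: Andre1996Motifs, §5.1 and Remarque 2 (p. 33)] -/
theorem comap_le_sup_iff_detect (hf : IsCompactAbelianPencil f d) (t : ComplexPoints S) {p q : ℕ} (hpq : p + q = d) :
    (algebraicClasses (fiberOver f t) p).comap (complexBetti.map (fiberι f t) (2 * p)).hom ≤
        algebraicClasses 𝒳 p ⊔ LinearMap.ker (complexBetti.map (fiberι f t) (2 * p)).hom ↔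
      ∀ b ∈ algebraicClasses (fiberOver f t) q ⊓ LinearMap.range (complexBetti.map (fiberι f t) (2 * q)).hom, b ≠ 0 →
        ∃ a ∈ algebraicClasses 𝒳 p,
          cupProduct (show 2 * p + 2 * q = 2 * d by omega) (complexBetti.map (fiberι f t) (2 * p) a) b ≠ 0 := by
  rw [comap_le_sup_iff_numericalInv hf t hpq]
  refine ⟨fun h b hb hb0 ↦ ?_, fun h b hb hab ↦ ?_⟩
  · by_contra hall
    push Not at hall
    have hj : fiberGysin hf t q b = 0 := h b hb fun a ha ↦ (cupProduct_map_fiberι_eq_zero_iff hf t hpq a b).1 (hall a ha)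
    obtain ⟨W, hW⟩ := hb.2
    have hW' : complexBetti.map (fiberι f t) (2 * q) W = b := hW
    rw [← hW'] at hj
    exact hb0 (by rw [← hW']; exact fibreGysinKernelOn_holds hf q t t W hj)
  · by_contra hb0
    have hbne : b ≠ 0 := by
      intro h0
      exact hb0 (by rw [h0, map_zero])
    obtain ⟨a, ha, hne⟩ := h b hb hbne
    exact hne ((cupProduct_map_fiberι_eq_zero_iff hf t hpq a b).2 (hab a ha))

/-- **(L)_t(p) ⟹ (Num₁)(p,q) of part XXIX-a** ("for `w ∈ N^q(𝒳)` with `a ∪ L_t w = 0` for all `a ∈ N^p(𝒳)`, `L_t w = 0`",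
`L_t = j_{t*} j_t^*`): the classes `j_t^* w` are invariant algebraic, so this is an instance of (Num_t)^{inv}(p,q).
[cite: Kleiman1968AlgebraicCycles, §3 (D(X))] -/
theorem numerical₁_of_comap_le_sup (hf : IsCompactAbelianPencil f d) (t : ComplexPoints S) {p q : ℕ} (hpq : p + q = d)
    (hL : (algebraicClasses (fiberOver f t) p).comap (complexBetti.map (fiberι f t) (2 * p)).hom ≤
      algebraicClasses 𝒳 p ⊔ LinearMap.ker (complexBetti.map (fiberι f t) (2 * p)).hom) :
    ∀ w ∈ algebraicClasses 𝒳 q,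
      (∀ a ∈ algebraicClasses 𝒳 p, cupProduct (show 2 * p + 2 * (q + 1) = 2 * (d + 1) by omega) a
          (fiberGysin hf t q (complexBetti.map (fiberι f t) (2 * q) w)) = 0) →
        fiberGysin hf t q (complexBetti.map (fiberι f t) (2 * q) w) = 0 :=
  fun w hw hab ↦ numericalInv_of_comap_le_sup hf t hpq hL (complexBetti.map (fiberι f t) (2 * q) w)
    (map_algebraicClasses_le_inf_range hf t q (Submodule.mem_map_of_mem hw)) hab

/-- **THE SMALLEST OPEN INSTANCE, `d = 4`, AS A FIND-THE-CYCLE PROBLEM.** For a compact pencil of abelian FOURFOLDS the lift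
holds in every degree `2p`, `p ≠ 2`, unconditionally (part XVIII-i); in degree `4` it holds at `t` IFF every non-zero invariant
algebraic SURFACE class `b` on the fourfold `X_t` meets the restriction of some algebraic THREEFOLD class `a` of the fivefold
`𝒳` non-trivially: `j_t^* a ∪ b ≠ 0`. [cite: Kleiman1968AlgebraicCycles, §3 (D(X))] [cite: Lieberman1968, Thm. 1] -/
theorem comap_le_sup_iff_detect_relDim_four {f : 𝒳 ⟶ S} (hf : IsCompactAbelianPencil f 4) (t : ComplexPoints S) :
    (∀ p : ℕ, (algebraicClasses (fiberOver f t) p).comap (complexBetti.map (fiberι f t) (2 * p)).hom ≤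
        algebraicClasses 𝒳 p ⊔ LinearMap.ker (complexBetti.map (fiberι f t) (2 * p)).hom) ↔
      ∀ b ∈ algebraicClasses (fiberOver f t) 2 ⊓ LinearMap.range (complexBetti.map (fiberι f t) (2 * 2)).hom, b ≠ 0 →
        ∃ a ∈ algebraicClasses 𝒳 2,
          cupProduct (show 2 * 2 + 2 * 2 = 2 * 4 by rfl) (complexBetti.map (fiberι f t) (2 * 2) a) b ≠ 0 := by
  rw [← comap_le_sup_iff_detect hf t (show 2 + 2 = 4 by rfl)]
  refine ⟨fun h ↦ h 2, fun h p ↦ ?_⟩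
  by_cases hp2 : p = 2
  · subst hp2
    exact h
  rcases le_or_gt p 4 with hp | hp
  · exact comap_le_sup_of_extreme hf t (show p + (4 - p) = 4 by omega) (by omega)
  · haveI := subsingleton_complexBetti (hf.isSmoothProjective_fiberOver t) (show 2 * 4 < 2 * p by omega)
    intro W _
    refine Submodule.mem_sup_right ?_
    rw [LinearMap.mem_ker]
    exact Subsingleton.elim _ _

end Summit.HodgeConjecture.HodgeConjecture.Ring2.AbelianAll

end
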